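import Summits.CriticalPhenomena.SAWScalingLimit.Theses.SAWLatticeVirasoro
import HarnessLib

/-! Strategist sketch 2 (crux stmt-CriticalPhenomena-14005 `ObservableToSLER`): the RANGE-FIRST cut of residue 3.
Item stmt-CriticalPhenomena-7148 `HexSimpleSubseqLimits` (simplicity + boundary avoidance of every subsequential limit) splits EXACTLY into
`SimpleRangeSubseqLimits` (the range of every subsequential limit is a simple arc from pt 0 to pt 1 meeting ∂D only at the marks — the half that the
LSW03 restriction characterisation of the FILLED range delivers without any modulus input) and `NoRetrace` (a subsequential limit whose range is a
simple arc with the same endpoints is the class of that arc — the genuinely a-priori half).  `item7148_of` is the sorry-free reduction. -/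

noncomputable section

open scoped Topology ENNReal NNReal BoundedContinuousFunction
open Filter Set MeasureTheory
open Literature.Probability.LatticeModels (HexVertex hexGraph hexCenter)
open Literature.Probability.RandomPlanarGeometry
open Literature.Probability.RandomPlanarGeometry.SAW

namespace Summit.CriticalPhenomena.SAWScalingLimit.Cruxes.ObservableToSLER.RangeFirst

/-- `γ` has the RANGE OF A SIMPLE ARC with the same endpoints. -/
def HasSimpleRange (γ : CurveClass ℂ) : Prop :=
  ∃ η ∈ CurveClass.simple, η.range = γ.range ∧ η.source = γ.source ∧ η.target = γ.target

/-- **SIMPLE-RANGE SUBSEQUENTIAL LIMITS** (the restriction-side half of item 7148): along every mesh sequence, every probability weak limit of the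
pushed-forward critical hexagonal SAW laws is carried by classes whose RANGE is a simple arc from `pt 0` to `pt 1` inside `closure D` meeting `∂D`
only at the marks.  Intended derivation: range-level two-piece identification (LSW03: the restriction formula determines the law of the filled
range; filled SLE(8/3) range is a simple boundary-avoiding arc; a compact connected subset of a simple arc containing both endpoints is the arc) +
the range-level nested transfer. -/
def SimpleRangeSubseqLimits : Prop :=
  ∀ (D : DobrushinDomain) (a b : ℝ → HexVertex), IsEmbEndpointApprox hexGraph hexCenter D a b →
    ∀ (s : ℕ → ℝ) (ν : Measure (CurveClass ℂ)), Tendsto s atTop (𝓝[>] 0) → IsProbabilityMeasure ν →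
      (∀ f : CurveClass ℂ →ᵇ ℝ,
        Tendsto (fun n => ∫ γ, f γ.curve ∂(hexSAWLaw D.carrier (s n) (a (s n)) (b (s n)))) atTop (𝓝 (∫ x, f x ∂ν))) →
      ∀ᵐ γ ∂ν, HasSimpleRange γ ∧ γ.source = D.pt 0 ∧ γ.target = D.pt 1 ∧
        γ.range ⊆ closure D.carrier ∧ γ.range ∩ frontier D.carrier ⊆ {D.pt 0, D.pt 1}

/-- **NO RETRACE** (the a-priori half of item 7148, strictly weaker than it): a subsequential limit of the critical hexagonal SAW laws whose
range is a simple arc with its own endpoints is a.s. SIMPLE — i.e. the limit curve does not traverse a sub-arc of its range three times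
(on the lattice: no three o(1)-close parallel macroscopic strands; in the walk's slit domain: the conditional future does not crawl back along
the past strand). -/
def NoRetrace : Prop :=
  ∀ (D : DobrushinDomain) (a b : ℝ → HexVertex), IsEmbEndpointApprox hexGraph hexCenter D a b →
    ∀ (s : ℕ → ℝ) (ν : Measure (CurveClass ℂ)), Tendsto s atTop (𝓝[>] 0) → IsProbabilityMeasure ν →
      (∀ f : CurveClass ℂ →ᵇ ℝ,
        Tendsto (fun n => ∫ γ, f γ.curve ∂(hexSAWLaw D.carrier (s n) (a (s n)) (b (s n)))) atTop (𝓝 (∫ x, f x ∂ν))) →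
      ∀ᵐ γ ∂ν, HasSimpleRange γ → γ ∈ CurveClass.simple

/-- **First lemma (checked): the cut is exact** — `SimpleRangeSubseqLimits → NoRetrace → item 7148`. -/
theorem item7148_of (h₁ : SimpleRangeSubseqLimits) (h₂ : NoRetrace) :
    Summit.CriticalPhenomena.SAWScalingLimit.Theses.SAWLatticeVirasoro.HexSimpleSubseqLimits := by
  intro D a b hab s ν hs hν hf
  filter_upwards [h₁ D a b hab s ν hs hν hf, h₂ D a b hab s ν hs hν hf] with γ hγ hn
  exact ⟨hn hγ.1, hγ.2.1, hγ.2.2.1, hγ.2.2.2.1, hγ.2.2.2.2⟩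

/-- Conversely item 7148 gives both halves (so the cut loses nothing). -/
theorem of_item7148 (h : Summit.CriticalPhenomena.SAWScalingLimit.Theses.SAWLatticeVirasoro.HexSimpleSubseqLimits) :
    SimpleRangeSubseqLimits ∧ NoRetrace := by
  refine ⟨fun D a b hab s ν hs hν hf => ?_, fun D a b hab s ν hs hν hf => ?_⟩
  · filter_upwards [h D a b hab s ν hs hν hf] with γ hγ
    exact ⟨⟨γ, hγ.1, rfl, rfl, rfl⟩, hγ.2.1, hγ.2.2.1, hγ.2.2.2.1, hγ.2.2.2.2⟩
  · filter_upwards [h D a b hab s ν hs hν hf] with γ hγ _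
    exact hγ.1

end Summit.CriticalPhenomena.SAWScalingLimit.Cruxes.ObservableToSLER.RangeFirst

end
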